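import Mathlib.Analysis.SpecialFunctions.Trigonometric.DerivHyp
import Mathlib.Analysis.SpecialFunctions.Log.Basic
import Summits.CriticalPhenomena.CardyFormulaZ2.Theorems.CardySelfDualSegmentSegmentClosedStubBoxCrossRatio
import Literature.Probability.RandomPlanarGeometry.RectangleModulusAspectRatio
import Literature.Probability.RandomPlanarGeometry.ImageUnivalent
import Literature.Probability.RandomPlanarGeometry.CardyFunctionIncBeta
import Literature.Probability.RandomPlanarGeometry.ChordalCurveFamily
import Literature.Analysis.Complex.HorizontalStripResidues
import HarnessLib

/-!
# Stub `stub_relativeConfinement` of line `birth`, crux `SegmentTransport` (stmt-CriticalPhenomena-11199)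

Route `ModulusResponse` of `CriticalPhenomena/CardyFormulaZ2`. **Relative confinement of near-Cardy
stretches** (pure conformal geometry, for an ARBITRARY set function `P : Set ℂ → ℝ → Set ℂ → Set ℂ → ℝ`):
there is a universal window `T` such that, for the pinned diagonal stretches
`S_t z = cosh t · z + i sinh t · z̄`, any two stretches `t, t'` at which `P` is `1/8`-approximately
linear-image Cardy for every conformal rectangle (eventually as the mesh `δ → 0⁺`) satisfy `|t - t'| ≤ T`.

Proof. Put `s = t - t'`. For a conformal rectangle `R`, the `t'`-hypothesis tested on the image
rectangle `S_s(R)` (`MarkedDomain.map` by the stretch homeomorphism) speaks about the SAME data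
`P (S_t R, δ, S_t arc₀, S_t arc₂)` as the `t`-hypothesis on `R`, because `S_{t'} ∘ S_s = S_t` (group
law); at a common small mesh this gives `|F(η(R)) - F(η(S_s R))| ≤ 1/4`. Test rectangles: the images
`g((0,w)×(0,h))` of the model boxes `rectQuad 0 w 0 h` under the frame `g z = (1+i) z` (sides along
the diagonals `x = ±y`, the eigen-directions of `S`); since `S_s (g z) = g (e^s x + i e^{-s} y)`, the
stretched rectangle is `g((0, e^s w)×(0, e^{-s} h))` with the corresponding corners, so by conformal
invariance of the cross-ratio (`crossRatio_eq_of_image_data`) and the box cross-ratio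
`1 - η(w/h)` (`SegmentClosed.Sketch.stub_boxCrossRatio` with Bollobás–Riordan's modulus function `η`,
`rectangle_crossRatio_eq_of_aspectRatio_holds`) we get `|G(r) - G(e^{2s} r)| ≤ 1/4` for all `r > 0`,
where `G(r) = F(1 - η(r))` is strictly increasing and takes the values `1/8` at `r₁` and `7/8` at
`r₂ > r₁` (`F` continuous and strictly increasing on `[0,1]`, `F(0) = 0`, `F(1) = 1`; `η` onto `(0,1)`).
Testing `r = r₁` excludes `s > T` and `r = r₂` excludes `s < -T`, `T = log (r₂/r₁) / 2`.

The few facts on the pinned stretches that are needed (real coordinates, group law, continuity, the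
plane homeomorphism `S_s` with inverse `S_{-s}`) are proved inline (`stretch_group`); the sibling stub file
`ModulusResponseSegmentTransportStubExactFromApproximate` has them as named lemmas (`…Birth.Exact.*`).
-/

noncomputable section

open Set Filter Metric Complex
open scoped Topology ComplexConjugate
open UpperHalfPlane (upperHalfPlaneSet)
open Literature.Probability.RandomPlanarGeometry
open Literature.Probability.Percolation (rectQuad rectQuad_carrier)

namespace Summit.CriticalPhenomena.CardyFormulaZ2.Cruxes.SegmentTransport.Birth

variable (S : ℝ → ℂ → ℂ)
  (hS : ∀ t z, S t z = (Real.cosh t : ℂ) * z + Complex.I * (Real.sinh t : ℂ) * (starRingEnd ℂ) z)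
include hS

/-- The frame `g z = (1 + i) z` (rotation by `π/4` composed with the dilation by `√2`) as a plane
homeomorphism (the tree's `similarity`; `1 + i ≠ 0` is the tree's `one_add_I_ne_zero`). -/
local notation "gFrame" => similarity (1 + I) Literature.Analysis.Complex.one_add_I_ne_zero 0

/-! ### The frame `g z = (1 + i) z` and diagonal rectangles -/

/-- **Conjugation of the stretch by the frame**: `S_s ((1+i) z) = (1+i) (e^s re z + i e^{-s} im z)` —
in the frame `g z = (1+i) z` (axes along the diagonals) the stretch is the axis stretch
`D_s (x + iy) = e^s x + i e^{-s} y`. -/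
theorem stretch_frame (s : ℝ) (z : ℂ) :
    S s ((1 + Complex.I) * z) = (1 + Complex.I) * ⟨Real.exp s * z.re, Real.exp (-s) * z.im⟩ := by
  rw [hS, Real.cosh_eq, Real.sinh_eq]
  apply Complex.ext
  · simp only [Complex.add_re, Complex.mul_re, Complex.mul_im, Complex.ofReal_re, Complex.ofReal_im,
      Complex.I_re, Complex.I_im, Complex.conj_re, Complex.conj_im, Complex.add_im, Complex.one_re,
      Complex.one_im]
    ring
  · simp only [Complex.add_im, Complex.mul_re, Complex.mul_im, Complex.ofReal_re, Complex.ofReal_im,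
      Complex.I_re, Complex.I_im, Complex.conj_re, Complex.conj_im, Complex.add_re, Complex.one_re,
      Complex.one_im]
    ring

/-- **The stretch group, packaged**: `S_s` is a plane homeomorphism, and composing with `S_a` adds
the parameters on images — `S_a '' (S_s(R)).carrier = S_{a+s} '' R.carrier` and likewise for the arcs
(real-coordinate formula, addition formulas for `cosh`/`sinh`, continuity). -/
theorem stretch_group (s : ℝ) : ∃ h : ℂ ≃ₜ ℂ, ⇑h = S s ∧ ∀ (R : ConformalRectangle) (a : ℝ),
    S a '' (R.map h).carrier = S (a + s) '' R.carrier ∧ ∀ i, S a '' (R.map h).arc i = S (a + s) '' R.arc i := by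
  have hre : ∀ t z, (S t z).re = Real.cosh t * z.re + Real.sinh t * z.im := fun t z ↦ by
    rw [hS]
    simp only [Complex.add_re, Complex.mul_re, Complex.mul_im, Complex.ofReal_re, Complex.ofReal_im,
      Complex.I_re, Complex.I_im, Complex.conj_re, Complex.conj_im]
    ring
  have him : ∀ t z, (S t z).im = Real.cosh t * z.im + Real.sinh t * z.re := fun t z ↦ by
    rw [hS]
    simp only [Complex.add_im, Complex.mul_re, Complex.mul_im, Complex.ofReal_re, Complex.ofReal_im,
      Complex.I_re, Complex.I_im, Complex.conj_re, Complex.conj_im]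
    ring
  have hadd : ∀ a b z, S a (S b z) = S (a + b) z := fun a b z ↦ by
    apply Complex.ext
    · rw [hre, hre, him, hre, Real.cosh_add, Real.sinh_add]; ring
    · rw [him, hre, him, him, Real.cosh_add, Real.sinh_add]; ring
  have hzero : ∀ z, S 0 z = z := fun z ↦ by
    apply Complex.ext
    · rw [hre]; simp
    · rw [him]; simp
  have hcont : ∀ t, Continuous (S t) := fun t ↦ by
    rw [show S t = fun z ↦ (Real.cosh t : ℂ) * z + Complex.I * (Real.sinh t : ℂ) * (starRingEnd ℂ) z from
      funext (hS t)]
    exact (continuous_const.mul continuous_id).add (continuous_const.mul Complex.continuous_conj)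
  refine ⟨{ toFun := S s, invFun := S (-s),
            left_inv := fun z ↦ by show S (-s) (S s z) = z; rw [hadd, neg_add_cancel, hzero],
            right_inv := fun z ↦ by show S s (S (-s) z) = z; rw [hadd, add_neg_cancel, hzero],
            continuous_toFun := hcont s, continuous_invFun := hcont (-s) }, rfl, fun R a ↦ ⟨?_, fun i ↦ ?_⟩⟩
  · show S a '' (S s '' R.carrier) = S (a + s) '' R.carrier
    rw [Set.image_image]
    exact congrArg (fun f : ℂ → ℂ ↦ f '' R.carrier) (funext fun z ↦ hadd a s z)
  · rw [MarkedDomain.arc_map]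
    show S a '' (S s '' R.arc i) = S (a + s) '' R.arc i
    rw [Set.image_image]
    exact congrArg (fun f : ℂ → ℂ ↦ f '' R.arc i) (funext fun z ↦ hadd a s z)

omit hS in
/-- The axis stretch maps the box `(0,w)×(0,h)` onto the box `(0, e^s w)×(0, e^{-s} h)`. -/
theorem image_axisStretch_reProdIm (s w h : ℝ) :
    (fun z : ℂ ↦ (⟨Real.exp s * z.re, Real.exp (-s) * z.im⟩ : ℂ)) '' (Ioo (0:ℝ) w ×ℂ Ioo (0:ℝ) h) =
      Ioo (0:ℝ) (Real.exp s * w) ×ℂ Ioo (0:ℝ) (Real.exp (-s) * h) := by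
  have hes : 0 < Real.exp s := Real.exp_pos s
  have hens : 0 < Real.exp (-s) := Real.exp_pos (-s)
  have hinv : Real.exp s * Real.exp (-s) = 1 := by rw [← Real.exp_add, add_neg_cancel, Real.exp_zero]
  ext z
  simp only [mem_image, mem_reProdIm, mem_Ioo]
  constructor
  · rintro ⟨z', ⟨⟨h1, h2⟩, h3, h4⟩, rfl⟩
    exact ⟨⟨mul_pos hes h1, mul_lt_mul_of_pos_left h2 hes⟩, mul_pos hens h3,
      mul_lt_mul_of_pos_left h4 hens⟩
  · rintro ⟨⟨h1, h2⟩, h3, h4⟩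
    refine ⟨⟨Real.exp (-s) * z.re, Real.exp s * z.im⟩, ⟨⟨mul_pos hens h1, ?_⟩, mul_pos hes h3, ?_⟩, ?_⟩
    · calc Real.exp (-s) * z.re < Real.exp (-s) * (Real.exp s * w) := mul_lt_mul_of_pos_left h2 hens
        _ = w := by rw [← mul_assoc, mul_comm (Real.exp (-s)), hinv, one_mul]
    · calc Real.exp s * z.im < Real.exp s * (Real.exp (-s) * h) := mul_lt_mul_of_pos_left h4 hes
        _ = h := by rw [← mul_assoc, hinv, one_mul]
    · apply Complex.ext
      · show Real.exp s * (Real.exp (-s) * z.re) = z.re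
        rw [← mul_assoc, hinv, one_mul]
      · show Real.exp (-s) * (Real.exp s * z.im) = z.im
        rw [← mul_assoc, mul_comm (Real.exp (-s)), hinv, one_mul]

omit hS in
/-- **Cross-ratio of the diagonal rectangle** `g((0,w)×(0,h))` (corners marked from `g 0`
counterclockwise, arcs `0`, `2` the images of the bottom and top sides): `1 - η(w/h)`, with `η`
Bollobás–Riordan's rectangle-modulus function (hypothesis `hη` = the `∀`-clause of
`rectangle_crossRatio_eq_of_aspectRatio`); the frame is a similarity, so the cross-ratio is that of
the model box (`crossRatio_eq_of_image_data`, `SegmentClosed.Sketch.stub_boxCrossRatio`). -/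
theorem crossRatio_diag (η : ℝ → ℝ)
    (hη : ∀ (R : ConformalRectangle) (w h : ℝ), 0 < w → 0 < h →
      R.carrier = (Ioo (0:ℝ) w ×ℂ Ioo (0:ℝ) h) →
      (R.pt 0 = (h:ℂ) * I ∧ R.pt 1 = 0 ∧ R.pt 2 = (w:ℂ) ∧ R.pt 3 = (w:ℂ) + (h:ℂ) * I) →
      ∀ (φ : ConformalEquiv upperHalfPlaneSet R.carrier) (x : Fin 4 → ℝ), R.IsUniformizing φ x →
        crossRatio x = η (w / h))
    {w h : ℝ} (hw : 0 < w) (hh : 0 < h)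
    {φ : ConformalEquiv upperHalfPlaneSet
      ((rectQuad 0 w 0 h hw hh).map gFrame).carrier}
    {x : Fin 4 → ℝ}
    (hux : ((rectQuad 0 w 0 h hw hh).map gFrame).IsUniformizing φ x) :
    crossRatio x = 1 - η (w / h) := by
  obtain ⟨φ₀, x₀, h₀⟩ := MarkedDomain.exists_isUniformizing_holds (rectQuad 0 w 0 h hw hh)
  have hd : DifferentiableOn ℂ (fun z : ℂ ↦ (1 + I) * z + 0) (rectQuad 0 w 0 h hw hh).carrier :=
    ((differentiable_id.const_mul _).add_const _).differentiableOn
  have hi : InjOn (fun z : ℂ ↦ (1 + I) * z + 0) (rectQuad 0 w 0 h hw hh).carrier :=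
    (gFrame).injective.injOn
  have hc : ContinuousOn (fun z : ℂ ↦ (1 + I) * z + 0) (closure (rectQuad 0 w 0 h hw hh).carrier) :=
    (gFrame).continuous.continuousOn
  have e := ConformalRectangle.crossRatio_eq_of_image_data (R := rectQuad 0 w 0 h hw hh)
    (S := (rectQuad 0 w 0 h hw hh).map gFrame)
    (h := fun z : ℂ ↦ (1 + I) * z + 0) hd hi hc rfl (fun _ ↦ rfl) h₀ hux
  rw [← e]
  exact Summit.CriticalPhenomena.CardyFormulaZ2.Cruxes.SegmentClosed.Sketch.stub_boxCrossRatio η hη hw hh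
    φ₀ x₀ h₀

/-- **Cross-ratio of the stretched diagonal rectangle**: for `h` acting as `S_s`, the image
`S_s(g((0,w)×(0,h)))` has cross-ratio `1 - η(e^{2s} · w/h)` — it IS the diagonal rectangle
`g((0, e^s w)×(0, e^{-s} h))` with the corresponding corners (`stretch_frame`), and the cross-ratio
is a conformal invariant (`crossRatio_eq_of_image_data` with the identity map). -/
theorem crossRatio_stretch_diag (η : ℝ → ℝ)
    (hη : ∀ (R : ConformalRectangle) (w h : ℝ), 0 < w → 0 < h →
      R.carrier = (Ioo (0:ℝ) w ×ℂ Ioo (0:ℝ) h) →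
      (R.pt 0 = (h:ℂ) * I ∧ R.pt 1 = 0 ∧ R.pt 2 = (w:ℂ) ∧ R.pt 3 = (w:ℂ) + (h:ℂ) * I) →
      ∀ (φ : ConformalEquiv upperHalfPlaneSet R.carrier) (x : Fin 4 → ℝ), R.IsUniformizing φ x →
        crossRatio x = η (w / h))
    {w h : ℝ} (hw : 0 < w) (hh : 0 < h) (s : ℝ) {hs : ℂ ≃ₜ ℂ} (hhs : ⇑hs = S s)
    {φ : ConformalEquiv upperHalfPlaneSet
      (((rectQuad 0 w 0 h hw hh).map gFrame).map hs).carrier}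
    {x : Fin 4 → ℝ}
    (hux : (((rectQuad 0 w 0 h hw hh).map gFrame).map hs).IsUniformizing
      φ x) :
    crossRatio x = 1 - η (Real.exp (2 * s) * (w / h)) := by
  have hw' : 0 < Real.exp s * w := mul_pos (Real.exp_pos s) hw
  have hh' : 0 < Real.exp (-s) * h := mul_pos (Real.exp_pos (-s)) hh
  -- the comparison rectangle `g((0, e^s w)×(0, e^{-s} h))`
  obtain ⟨φ₁, x₁, h₁⟩ := MarkedDomain.exists_isUniformizing_holds
    ((rectQuad 0 (Real.exp s * w) 0 (Real.exp (-s) * h) hw' hh').map gFrame)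
  -- same carrier
  have hcar : (((rectQuad 0 w 0 h hw hh).map gFrame).map hs).carrier =
      id '' ((rectQuad 0 (Real.exp s * w) 0 (Real.exp (-s) * h) hw' hh').map
        gFrame).carrier := by
    rw [image_id, MarkedDomain.carrier_map, MarkedDomain.carrier_map, MarkedDomain.carrier_map, hhs,
      rectQuad_carrier, rectQuad_carrier, ← image_axisStretch_reProdIm s w h, image_image, image_image]
    refine congrArg (fun f : ℂ → ℂ ↦ f '' (Ioo (0:ℝ) w ×ℂ Ioo (0:ℝ) h)) (funext fun z ↦ ?_)
    show S s ((1 + I) * z + 0) = (1 + I) * ⟨Real.exp s * z.re, Real.exp (-s) * z.im⟩ + 0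
    rw [add_zero, add_zero, stretch_frame S hS]
  -- same marked points
  obtain ⟨p0, p1, p2, p3⟩ :=
    Summit.CriticalPhenomena.CardyFormulaZ2.Cruxes.SegmentClosed.Sketch.BoxCrossRatio.rectQuad_pt hw hh
      (x₀ := 0) (y₀ := 0)
  obtain ⟨q0, q1, q2, q3⟩ :=
    Summit.CriticalPhenomena.CardyFormulaZ2.Cruxes.SegmentClosed.Sketch.BoxCrossRatio.rectQuad_pt hw' hh'
      (x₀ := 0) (y₀ := 0)
  have hpt : ∀ i, (((rectQuad 0 w 0 h hw hh).map gFrame).map hs).pt i =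
      id (((rectQuad 0 (Real.exp s * w) 0 (Real.exp (-s) * h) hw' hh').map
        gFrame).pt i) := by
    intro i
    rw [id, MarkedDomain.pt_map, MarkedDomain.pt_map, MarkedDomain.pt_map, hhs, similarity_apply,
      similarity_apply, add_zero, add_zero, stretch_frame S hS]
    congr 1
    fin_cases i
    · show (⟨Real.exp s * ((rectQuad 0 w 0 h hw hh).pt 0).re, Real.exp (-s) * ((rectQuad 0 w 0 h hw hh).pt 0).im⟩ : ℂ) =
        (rectQuad 0 (Real.exp s * w) 0 (Real.exp (-s) * h) hw' hh').pt 0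
      rw [p0, q0]; apply Complex.ext <;> simp
    · show (⟨Real.exp s * ((rectQuad 0 w 0 h hw hh).pt 1).re, Real.exp (-s) * ((rectQuad 0 w 0 h hw hh).pt 1).im⟩ : ℂ) =
        (rectQuad 0 (Real.exp s * w) 0 (Real.exp (-s) * h) hw' hh').pt 1
      rw [p1, q1]; apply Complex.ext <;> simp
    · show (⟨Real.exp s * ((rectQuad 0 w 0 h hw hh).pt 2).re, Real.exp (-s) * ((rectQuad 0 w 0 h hw hh).pt 2).im⟩ : ℂ) =
        (rectQuad 0 (Real.exp s * w) 0 (Real.exp (-s) * h) hw' hh').pt 2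
      rw [p2, q2]
    · show (⟨Real.exp s * ((rectQuad 0 w 0 h hw hh).pt 3).re, Real.exp (-s) * ((rectQuad 0 w 0 h hw hh).pt 3).im⟩ : ℂ) =
        (rectQuad 0 (Real.exp s * w) 0 (Real.exp (-s) * h) hw' hh').pt 3
      rw [p3, q3]; apply Complex.ext <;> simp
  have e := ConformalRectangle.crossRatio_eq_of_image_data
    (R := (rectQuad 0 (Real.exp s * w) 0 (Real.exp (-s) * h) hw' hh').map
      gFrame)
    (S := ((rectQuad 0 w 0 h hw hh).map gFrame).map hs)
    (h := id) differentiableOn_id (injOn_id _) continuousOn_id hcar hpt h₁ hux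
  rw [← e, crossRatio_diag η hη hw' hh' h₁]
  congr 2
  have hne : Real.exp s ≠ 0 := (Real.exp_pos s).ne'
  rw [Real.exp_neg, two_mul, Real.exp_add]
  field_simp

/-! ### The modulus function along the stretch: `G(r) = F(1 - η(r))` -/

omit hS in
/-- `G(r) = F(1 - η(r))` is strictly increasing on `(0,∞)` (`η` strictly decreasing into `(0,1)`,
`F` strictly increasing on `[0,1]`). -/
theorem cardy_one_sub_lt {η : ℝ → ℝ} (hanti : StrictAntiOn η (Ioi 0)) (himg : η '' Ioi 0 = Ioo 0 1)
    {r r' : ℝ} (hr : 0 < r) (hrr' : r < r') :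
    cardyFunction (1 - η r) < cardyFunction (1 - η r') := by
  have hηr : η r ∈ Ioo (0:ℝ) 1 := by rw [← himg]; exact ⟨r, hr, rfl⟩
  have hηr' : η r' ∈ Ioo (0:ℝ) 1 := by rw [← himg]; exact ⟨r', hr.trans hrr', rfl⟩
  have hlt : η r' < η r := hanti (show r ∈ Ioi (0:ℝ) from hr) (show r' ∈ Ioi (0:ℝ) from hr.trans hrr') hrr'
  exact strictMonoOn_cardyFunction_holds ⟨by linarith [hηr.2], by linarith [hηr.1]⟩
    ⟨by linarith [hηr'.2], by linarith [hηr'.1]⟩ (by linarith)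

omit hS in
/-- Every value `v ∈ (0,1)` is `G(r) = F(1 - η(r))` for some aspect ratio `r > 0` (`F` is continuous
on `[0,1]` with `F(0) = 0`, `F(1) = 1`; `η` maps `(0,∞)` onto `(0,1)`). -/
theorem exists_cardy_one_sub_eq {η : ℝ → ℝ} (himg : η '' Ioi 0 = Ioo 0 1) {v : ℝ} (hv : v ∈ Ioo (0:ℝ) 1) :
    ∃ r : ℝ, 0 < r ∧ cardyFunction (1 - η r) = v := by
  have hv' : v ∈ Ioo (cardyFunction 0) (cardyFunction 1) := by
    rw [cardyFunction_zero, cardyFunction_one_holds]; exact hv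
  obtain ⟨y, hy, hFy⟩ := intermediate_value_Ioo zero_le_one continuousOn_cardyFunction_holds hv'
  have h1y : 1 - y ∈ η '' Ioi 0 := by rw [himg]; exact ⟨by linarith [hy.2], by linarith [hy.1]⟩
  obtain ⟨r, hr, hηr⟩ := h1y
  exact ⟨r, hr, by rw [hηr, sub_sub_cancel, hFy]⟩

/-! ### The stub -/

omit S hS in
/-- **STUB `stub_relativeConfinement` (line `birth`, crux `SegmentTransport`) — relative confinement
of near-Cardy stretches (pure conformal geometry; `P` is an ARBITRARY set function).** There is a
universal window `T` such that, for the pinned stretches `S_t`, any two stretches `t, t'` at which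
`P` is `1/8`-approximately linear-image Cardy for every conformal rectangle and every uniformizing
datum (eventually as the mesh `δ → 0⁺`) satisfy `|t - t'| ≤ T`. Proof: see the module docstring
(`T = log (r₂/r₁) / 2` with `F(1 - η(r₁)) = 1/8`, `F(1 - η(r₂)) = 7/8`). -/
theorem stub_relativeConfinement :
    ∃ T : ℝ, ∀ (P : Set ℂ → ℝ → Set ℂ → Set ℂ → ℝ) (S : ℝ → ℂ → ℂ), (∀ t z, S t z = (Real.cosh t : ℂ) * z + Complex.I * (Real.sinh t : ℂ) * (starRingEnd ℂ) z) → ∀ t t' : ℝ, (∀ (R : Literature.Probability.RandomPlanarGeometry.ConformalRectangle) (φ : Literature.Probability.RandomPlanarGeometry.ConformalEquiv UpperHalfPlane.upperHalfPlaneSet R.carrier) (x : Fin 4 → ℝ), R.IsUniformizing φ x → ∀ᶠ δ in nhdsWithin (0 : ℝ) (Set.Ioi 0), |P (S t '' R.carrier) δ (S t '' R.arc 0) (S t '' R.arc 2) - Literature.Probability.RandomPlanarGeometry.cardyFunction (Literature.Probability.RandomPlanarGeometry.crossRatio x)| ≤ 1 / 8) → (∀ (R : Literature.Probability.RandomPlanarGeometry.ConformalRectangle)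 (φ : Literature.Probability.RandomPlanarGeometry.ConformalEquiv UpperHalfPlane.upperHalfPlaneSet R.carrier) (x : Fin 4 → ℝ), R.IsUniformizing φ x → ∀ᶠ δ in nhdsWithin (0 : ℝ) (Set.Ioi 0), |P (S t' '' R.carrier) δ (S t' '' R.arc 0) (S t' '' R.arc 2) - Literature.Probability.RandomPlanarGeometry.cardyFunction (Literature.Probability.RandomPlanarGeometry.crossRatio x)| ≤ 1 / 8) → |t - t'| ≤ T := by
  obtain ⟨η, hanti, himg, hrect⟩ := rectangle_crossRatio_eq_of_aspectRatio_holds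
  obtain ⟨r₁, hr₁, hG₁⟩ := exists_cardy_one_sub_eq himg (v := 1 / 8) ⟨by norm_num, by norm_num⟩
  obtain ⟨r₂, hr₂, hG₂⟩ := exists_cardy_one_sub_eq himg (v := 7 / 8) ⟨by norm_num, by norm_num⟩
  have h12 : r₁ < r₂ := by
    by_contra hle
    rcases (not_lt.1 hle).eq_or_lt with heq | hlt
    · rw [heq] at hG₂; linarith
    · have := cardy_one_sub_lt hanti himg hr₂ hlt; linarith
  have hq : 0 < r₂ / r₁ := div_pos hr₂ hr₁
  refine ⟨Real.log (r₂ / r₁) / 2, ?_⟩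
  intro P S hS t t' ht ht'
  -- the key comparison: `|G(r) - G(e^{2(t-t')} r)| ≤ 1/4` for every aspect ratio `r`
  have key : ∀ r : ℝ, 0 < r → |cardyFunction (1 - η r) -
      cardyFunction (1 - η (Real.exp (2 * (t - t')) * r))| ≤ 1 / 4 := by
    intro r hr
    obtain ⟨hs, hhs, hgrp⟩ := stretch_group S hS (t - t')
    obtain ⟨φ, x, hux⟩ := MarkedDomain.exists_isUniformizing_holds
      ((rectQuad 0 r 0 1 hr one_pos).map gFrame)
    obtain ⟨φ', x', hux'⟩ := MarkedDomain.exists_isUniformizing_holds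
      (((rectQuad 0 r 0 1 hr one_pos).map gFrame).map hs)
    have e1 : crossRatio x = 1 - η r := by
      rw [crossRatio_diag η hrect hr one_pos hux, div_one]
    have e2 : crossRatio x' = 1 - η (Real.exp (2 * (t - t')) * r) := by
      rw [crossRatio_stretch_diag S hS η hrect hr one_pos (t - t') hhs hux', div_one]
    have h1 := ht _ φ x hux
    have h2 := ht' _ φ' x' hux'
    obtain ⟨hgc, hga⟩ := hgrp ((rectQuad 0 r 0 1 hr one_pos).map gFrame) t'
    rw [hgc, hga, hga, show t' + (t - t') = t by ring] at h2
    obtain ⟨δ, hδ1, hδ2⟩ := (h1.and h2).exists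
    rw [e1] at hδ1
    rw [e2] at hδ2
    calc |cardyFunction (1 - η r) - cardyFunction (1 - η (Real.exp (2 * (t - t')) * r))|
        ≤ |P (S t '' ((rectQuad 0 r 0 1 hr one_pos).map gFrame).carrier) δ
              (S t '' ((rectQuad 0 r 0 1 hr one_pos).map gFrame).arc 0)
              (S t '' ((rectQuad 0 r 0 1 hr one_pos).map gFrame).arc 2) -
            cardyFunction (1 - η r)| +
          |P (S t '' ((rectQuad 0 r 0 1 hr one_pos).map gFrame).carrier) δ
              (S t '' ((rectQuad 0 r 0 1 hr one_pos).map gFrame).arc 0)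
              (S t '' ((rectQuad 0 r 0 1 hr one_pos).map gFrame).arc 2) -
            cardyFunction (1 - η (Real.exp (2 * (t - t')) * r))| := by
          rw [abs_sub_comm (P _ _ _ _) (cardyFunction (1 - η r))]
          exact abs_sub_le _ _ _
      _ ≤ 1 / 8 + 1 / 8 := add_le_add hδ1 hδ2
      _ = 1 / 4 := by norm_num
  rw [abs_le]
  constructor
  · -- `t - t' ≥ -T`: otherwise `e^{2(t-t')} r₂ < r₁` and `G` drops from `7/8` below `1/8`
    by_contra H
    rw [not_le] at H
    have h2s : 2 * (t - t') < Real.log (r₁ / r₂) := by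
      rw [← inv_div, Real.log_inv]; linarith
    have hexp : Real.exp (2 * (t - t')) < r₁ / r₂ := by
      calc Real.exp (2 * (t - t')) < Real.exp (Real.log (r₁ / r₂)) := Real.exp_lt_exp.2 h2s
        _ = r₁ / r₂ := Real.exp_log (div_pos hr₁ hr₂)
    have hlt : Real.exp (2 * (t - t')) * r₂ < r₁ := (lt_div_iff₀ hr₂).1 hexp
    have hG := cardy_one_sub_lt hanti himg (mul_pos (Real.exp_pos _) hr₂) hlt
    have hk := key r₂ hr₂
    rw [hG₂] at hk
    rw [hG₁] at hG
    have := (abs_le.1 hk).2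
    linarith
  · -- `t - t' ≤ T`: otherwise `e^{2(t-t')} r₁ > r₂` and `G` jumps from `1/8` above `7/8`
    by_contra H
    rw [not_le] at H
    have h2s : Real.log (r₂ / r₁) < 2 * (t - t') := by linarith
    have hexp : r₂ / r₁ < Real.exp (2 * (t - t')) := by
      calc r₂ / r₁ = Real.exp (Real.log (r₂ / r₁)) := (Real.exp_log hq).symm
        _ < Real.exp (2 * (t - t')) := Real.exp_lt_exp.2 h2s
    have hlt : r₂ < Real.exp (2 * (t - t')) * r₁ := (div_lt_iff₀ hr₁).1 hexp
    have hG := cardy_one_sub_lt hanti himg hr₂ hlt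
    have hk := key r₁ hr₁
    rw [hG₁] at hk
    rw [hG₂] at hG
    have := (abs_le.1 hk).1
    linarith

end Summit.CriticalPhenomena.CardyFormulaZ2.Cruxes.SegmentTransport.Birth

end
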